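import Summits.Ventures.PercRepro.S2ContractionSeven

/-!
# PercRepro — S2: THE TOP `8`-SETS THROUGH `W`, THE REFINED CLASSES OF THE CONTRACTION LEVER (p7, gen 17; sub-claim S2; for the
case `ν = d − 2` of the cells `(13, 8 …)`)

For the top `8`-sets (`ρ(B) = 5`, `E ∖ B` spanning, `|B ∩ W| ≥ 6`) the lever `S2.contract_dep_sdiff_of_dep_of_indep_inter` applied
to a BASIS `J` of `B ∩ W` (`ρ(J ∪ (B ∖ W)) = ρ(B) = 5 < |J| + |B ∖ W|` once `|J| + |B ∖ W| ≥ 6`, exactly as in S2ContractionSeven)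
makes the outside pair `N`-dependent whenever the trace has rank `≥ 4`: **`ncard_top_eight_le_contract`** —
  `#{top 8-sets} ≤ R₆⁴(W)·D₂(N) + R₆³(W)·C(|E ∖ W|, 2) + C(|W|, 7)·|E ∖ W| + C(|W|, 8)`
(`R₆⁴` = the `6`-subsets of `W` of rank `≥ 4`, `R₆³` those of rank `≤ 3`, `D₂(N)` the `N`-dependent pairs outside `W`,
`N := M ／ W`). At `ν = d − 2` the contraction has nullity `2`, `D₂(N) ≤ 3`, and `R₆³` is bounded by the dependent `4`-subsets
(S2SmallRankSubsets) — against the kit's `C(|W|, 6)·C(|E ∖ W|, 2)`. Axioms: standard.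
-/

open scoped Matroid

namespace PercRepro

namespace S2

open Set

variable {α : Type}

/-- **The top `8`-sets through `W`, refined** (see the module docstring). -/
theorem ncard_top_eight_le_contract (M : Matroid α) [M.Finite] {W : Set α} (hW : W ⊆ M.E)
    (hhit : ∀ B, B ⊆ M.E → B.ncard = 8 → M.eRk B = 5 → M.eRk (M.E \ B) = M.eRank → 6 ≤ (B ∩ W).ncard) :
    {B : Set α | B ⊆ M.E ∧ B.ncard = 8 ∧ M.eRk B = 5 ∧ M.eRk (M.E \ B) = M.eRank}.ncard ≤
      {T : Set α | T ⊆ W ∧ T.ncard = 6 ∧ 4 ≤ M.eRk T}.ncard *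
          {X : Set α | X ⊆ M.E \ W ∧ X.ncard = 2 ∧ (M ／ W).Dep X}.ncard +
        {T : Set α | T ⊆ W ∧ T.ncard = 6 ∧ M.eRk T ≤ 3}.ncard * (M.E \ W).ncard.choose 2 +
        W.ncard.choose 7 * (M.E \ W).ncard + W.ncard.choose 8 := by
  classical
  set Top := {B : Set α | B ⊆ M.E ∧ B.ncard = 8 ∧ M.eRk B = 5 ∧ M.eRk (M.E \ B) = M.eRank} with hTop
  have hWfin : W.Finite := M.ground_finite.subset hW
  have hRfin : (M.E \ W).Finite := M.ground_finite.sdiff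
  have hTopfin : Top.Finite := M.ground_finite.finite_subsets.subset (fun B hB => hB.1)
  have hPWfin : ∀ k, {T : Set α | T ⊆ W ∧ T.ncard = k}.Finite := fun k => hWfin.finite_subsets.subset (fun T hT => hT.1)
  have hPRfin : ∀ k, {X : Set α | X ⊆ M.E \ W ∧ X.ncard = k}.Finite := fun k => hRfin.finite_subsets.subset (fun X hX => hX.1)
  have hsplit : ∀ B ∈ Top, (B ∩ W).ncard + (B \ W).ncard = 8 := by
    rintro B ⟨hBE, hB8, -, -⟩
    rw [← hB8]
    exact Set.ncard_inter_add_ncard_sdiff_eq_ncard B W (M.ground_finite.subset hBE)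
  -- the lever on a basis `J` of `B ∩ W`
  have hkey : ∀ B ∈ Top, ∀ J : Set α, M.IsBasis J (B ∩ W) → 5 < J.ncard + (B \ W).ncard → (M ／ W).Dep (B \ W) := by
    rintro B ⟨hBE, hB8, hB5, hBs⟩ J hJ hcard
    have hBfin : B.Finite := M.ground_finite.subset hBE
    have hJW : J ⊆ W := hJ.subset.trans Set.inter_subset_right
    have hJfin : J.Finite := hWfin.subset hJW
    set B'' := J ∪ (B \ W) with hB''
    have hB''E : B'' ⊆ M.E := Set.union_subset (hJW.trans hW) (sdiff_subset.trans hBE)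
    have hB''fin : B''.Finite := hJfin.union hBfin.sdiff
    have hr1 : M.eRk B'' ≤ M.eRk B := M.eRk_mono (Set.union_subset (hJ.subset.trans Set.inter_subset_left) sdiff_subset)
    have hB''dep : M.Dep B'' := by
      rw [← Matroid.eRk_lt_encard_iff_dep_of_finite hB''fin hB''E]
      have hc : B''.encard = ((J.ncard + (B \ W).ncard : ℕ) : ℕ∞) := by
        rw [hB'', Set.encard_union_eq (Set.disjoint_left.2 (fun x hxJ hxB => hxB.2 (hJW hxJ))),
          ← hJfin.cast_ncard_eq, ← hBfin.sdiff.cast_ncard_eq]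
        push_cast
        ring
      rw [hc]
      calc M.eRk B'' ≤ M.eRk B := hr1
        _ = 5 := hB5
        _ < ((J.ncard + (B \ W).ncard : ℕ) : ℕ∞) := by exact_mod_cast hcard
    have hinter : B'' ∩ W = J := by
      ext x
      constructor
      · rintro ⟨hx, hxW⟩
        rcases hx with hxJ | hxB
        · exact hxJ
        · exact absurd hxW hxB.2
      · intro hxJ
        exact ⟨Or.inl hxJ, hJW hxJ⟩
    have hsd : B'' \ W = B \ W := by
      ext x
      constructor
      · rintro ⟨hx, hxW⟩
        rcases hx with hxJ | hxB
        · exact absurd (hJW hxJ) hxW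
        · exact hxB
      · intro hx
        exact ⟨Or.inr hx, hx.2⟩
    have := contract_dep_sdiff_of_dep_of_indep_inter M hW hB''E hB''dep (hinter ▸ hJ.indep)
    rwa [hsd] at this
  -- the classes
  let A1 : Set (Set α) := {B ∈ Top | (B ∩ W).ncard = 6 ∧ 4 ≤ M.eRk (B ∩ W)}
  let A2 : Set (Set α) := {B ∈ Top | (B ∩ W).ncard = 6 ∧ M.eRk (B ∩ W) ≤ 3}
  let A3 : Set (Set α) := {B ∈ Top | (B ∩ W).ncard = 7}
  let A4 : Set (Set α) := {B ∈ Top | (B ∩ W).ncard = 8}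
  have hcover : Top ⊆ A1 ∪ A2 ∪ A3 ∪ A4 := by
    intro B hB
    have hB' := hB
    obtain ⟨hBE, hB8, hB5, hBs⟩ := hB'
    have hBfin : B.Finite := M.ground_finite.subset hBE
    have hj1 : 6 ≤ (B ∩ W).ncard := hhit B hBE hB8 hB5 hBs
    have hj2 : (B ∩ W).ncard ≤ 8 := hB8 ▸ Set.ncard_le_ncard Set.inter_subset_left hBfin
    rcases (show (B ∩ W).ncard = 6 ∨ (B ∩ W).ncard = 7 ∨ (B ∩ W).ncard = 8 by omega) with h6 | h7 | h8
    · by_cases hr : 4 ≤ M.eRk (B ∩ W)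
      · exact Or.inl (Or.inl (Or.inl ⟨hB, h6, hr⟩))
      · push Not at hr
        have hr' : M.eRk (B ∩ W) ≤ 3 := by
          have h : M.eRk (B ∩ W) < (3 : ℕ∞) + 1 := by
            rw [show (3 : ℕ∞) + 1 = 4 by norm_num]
            exact hr
          exact Order.le_of_lt_add_one h
        exact Or.inl (Or.inl (Or.inr ⟨hB, h6, hr'⟩))
    · exact Or.inl (Or.inr ⟨hB, h7⟩)
    · exact Or.inr ⟨hB, h8⟩
  have hinj : Set.InjOn (fun B : Set α => (B ∩ W, B \ W)) Top := by
    rintro B₁ - B₂ - hEq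
    simp only [Prod.mk.injEq] at hEq
    rw [← Set.inter_union_sdiff B₁ W, ← Set.inter_union_sdiff B₂ W, hEq.1, hEq.2]
  have hsubTop : ∀ {S : Set (Set α)}, S ⊆ Top → Set.InjOn (fun B : Set α => (B ∩ W, B \ W)) S :=
    fun hS => hinj.mono hS
  -- A1: a basis of `≥ 4` points of `B ∩ W`; the outside pair is `N`-dependent
  have hA1 : A1.ncard ≤ {T : Set α | T ⊆ W ∧ T.ncard = 6 ∧ 4 ≤ M.eRk T}.ncard *
      {X : Set α | X ⊆ M.E \ W ∧ X.ncard = 2 ∧ (M ／ W).Dep X}.ncard := by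
    rw [← Set.ncard_prod]
    refine Set.ncard_le_ncard_of_injOn _ ?_ (hsubTop (fun B hB => hB.1))
      (((hPWfin 6).subset (fun T hT => ⟨hT.1, hT.2.1⟩)).prod ((hPRfin 2).subset (fun X hX => ⟨hX.1, hX.2.1⟩)))
    rintro B ⟨hB, h6, hr⟩
    have hs := hsplit B hB
    have hTE : B ∩ W ⊆ M.E := Set.inter_subset_left.trans hB.1
    obtain ⟨J, hJ⟩ := M.exists_isBasis (B ∩ W) hTE
    have hJc : 4 ≤ J.ncard := by
      have h := hJ.encard_eq_eRk
      rw [← (hWfin.subset (hJ.subset.trans Set.inter_subset_right)).cast_ncard_eq] at h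
      have : ((4 : ℕ) : ℕ∞) ≤ ((J.ncard : ℕ) : ℕ∞) := by rw [h]; exact_mod_cast hr
      exact_mod_cast this
    refine Set.mem_prod.2 ⟨⟨Set.inter_subset_right, h6, hr⟩, ⟨sdiff_subset_sdiff_left hB.1, ?_, hkey B hB J hJ (by omega)⟩⟩
    show (B \ W).ncard = 2
    omega
  -- A2: rank `≤ 3`, the crude count
  have hA2 : A2.ncard ≤ {T : Set α | T ⊆ W ∧ T.ncard = 6 ∧ M.eRk T ≤ 3}.ncard * (M.E \ W).ncard.choose 2 := by
    rw [← ncard_subsets_ncard_eq (M.E \ W) hRfin 2, ← Set.ncard_prod]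
    refine Set.ncard_le_ncard_of_injOn _ ?_ (hsubTop (fun B hB => hB.1))
      (((hPWfin 6).subset (fun T hT => ⟨hT.1, hT.2.1⟩)).prod (hPRfin 2))
    rintro B ⟨hB, h6, hr⟩
    have hs := hsplit B hB
    refine Set.mem_prod.2 ⟨⟨Set.inter_subset_right, h6, hr⟩, ⟨sdiff_subset_sdiff_left hB.1, ?_⟩⟩
    show (B \ W).ncard = 2
    omega
  -- A3: seven points inside, one outside
  have hA3 : A3.ncard ≤ W.ncard.choose 7 * (M.E \ W).ncard := by
    have h1 : (M.E \ W).ncard = (M.E \ W).ncard.choose 1 := (Nat.choose_one_right _).symm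
    rw [h1, ← ncard_subsets_ncard_eq W hWfin 7, ← ncard_subsets_ncard_eq (M.E \ W) hRfin 1, ← Set.ncard_prod]
    refine Set.ncard_le_ncard_of_injOn _ ?_ (hsubTop (fun B hB => hB.1)) ((hPWfin 7).prod (hPRfin 1))
    rintro B ⟨hB, h7⟩
    have hs := hsplit B hB
    refine Set.mem_prod.2 ⟨⟨Set.inter_subset_right, h7⟩, ⟨sdiff_subset_sdiff_left hB.1, ?_⟩⟩
    show (B \ W).ncard = 1
    omega
  -- A4: inside `W`
  have hA4 : A4.ncard ≤ W.ncard.choose 8 := by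
    rw [← ncard_subsets_ncard_eq W hWfin 8]
    refine Set.ncard_le_ncard ?_ (hPWfin 8)
    rintro B ⟨hB, h8⟩
    have hs := hsplit B hB
    have hBW : B ⊆ W := by
      have h0 : (B \ W).ncard = 0 := by omega
      rw [Set.ncard_eq_zero (M.ground_finite.subset hB.1).sdiff] at h0
      exact Set.sdiff_eq_empty.1 h0
    exact ⟨hBW, hB.2.1⟩
  have hAfin : ∀ {S : Set (Set α)}, S ⊆ Top → S.Finite := fun hS => hTopfin.subset hS
  have hu := Set.ncard_le_ncard hcover (((hAfin (fun B hB => hB.1)).union (hAfin (fun B hB => hB.1))).union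
    (hAfin (fun B hB => hB.1)) |>.union (hAfin (fun B hB => hB.1)))
  have hu1 := Set.ncard_union_le (A1 ∪ A2 ∪ A3) A4
  have hu2 := Set.ncard_union_le (A1 ∪ A2) A3
  have hu3 := Set.ncard_union_le A1 A2
  omega

end S2

end PercRepro
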